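import Summits.BirchSwinnertonDyer.BirchSwinnertonDyer.Theses.PrintX8VSC
import Summits.BirchSwinnertonDyer.BirchSwinnertonDyer.Theorems.SignedLowerHalvesSharpFlatCharValueRankZeroAllLevelsHolds
import HarnessLib

/-!
# Route `PrintX8VSC` (print-keyed repair twin of `PrintX8VS`; born 2026-08-28T22:36Z), aside item stmt-BirchSwinnertonDyer-23751
# `InputLem59AllN` — Sprung 2024 Lemma 5.9 at all levels (`Sprung2024.lem59AllN_sharpFlatCharValue_rankZero`, INPUTS-LIST-2 row F16) —
# PROVED, by the kernel theorem already landed for its twin item 19878 (`SharpFlatCount.lem59AllN_sharpFlatCharValue_rankZero_holds`)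

Cell `bsd-ssimc`, width seat `cruxlead-stmt-BirchSwinnertonDyer-19875-w3` (gen 10) under the 19875 LEAD. The born aside decl
`PrintX8VSC.InputLem59AllN` unfolds to the named fact `Sprung2024.lem59AllN_sharpFlatCharValue_rankZero`, which is an UNCONDITIONAL
theorem of the tree since 2026-08-28 (INPUTS seat `bsd-inputs-honda-p1` g6, `Theorems/SignedLowerHalvesSharpFlatCharValueRankZeroAllLevelsHolds.lean`:
the ♯/♭ characteristic-value formula in analytic rank 0 at every level, from Greenberg's engine, Cassels out of Poitou–Tate, `Ш² = 0` at an odd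
supersingular prime, Sprung 2012 Props. 7.3/7.6 and Thm. 2.2 — with both Poitou–Tate rows now kernel theorems). This file points that theorem
at the new decl. Effect: conjunct (v) of `PublishedInputsX8Contra` is a theorem, not a citation. HONEST FRAMING: no new mathematics here;
BSD / K′ / C′ / MC′ untouched.

References: [Sprung2024] Lemmas 5.5, 5.9, §5.2 (pp. 39–41), Props. 7.3, 7.6; [GreenbergLNM1716] §4; [MilneADT2006] Ch. I, Thm. 4.10; route file
`Theses/PrintX8VSC.lean` (rev 2, item 23751).
-/

set_option autoImplicit false
-- justification: the mandated namespace `Summit.BirchSwinnertonDyer.BirchSwinnertonDyer.Theorems`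
-- (single-conjunct summit, Sub = Summit) repeats a segment by design (D-0017).
set_option linter.dupNamespace false

namespace Summit.BirchSwinnertonDyer.BirchSwinnertonDyer.Theorems.PrintX8VSCGlue

open Summit.BirchSwinnertonDyer.BirchSwinnertonDyer.Theorems
  Summit.BirchSwinnertonDyer.BirchSwinnertonDyer.Theses.PrintX8VSC

/-- **Item stmt-BirchSwinnertonDyer-23751 `PrintX8VSC.InputLem59AllN` — Sprung 2024 Lemma 5.9 (all levels) — holds, unconditionally**:
by `SharpFlatCount.lem59AllN_sharpFlatCharValue_rankZero_holds` (the twin 19878's closer). [cite: Sprung2024, Lemma 5.9 and §5.2 (pp. 39–41)]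
[cite: MilneADT2006, Ch. I, Thm. 4.10] -/
theorem inputLem59AllN_holds : Theses.PrintX8VSC.InputLem59AllN := by
  unfold Theses.PrintX8VSC.InputLem59AllN
  exact SharpFlatCount.lem59AllN_sharpFlatCharValue_rankZero_holds

end Summit.BirchSwinnertonDyer.BirchSwinnertonDyer.Theorems.PrintX8VSCGlue
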